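import Summits.QuantumFields.YangMills.Theorems.ConvexGribovBodyContinuumLegGivenGapCsclChordSlack
import HarnessLib

/-!
# `ContinuumLegGivenGap` (stmt-QuantumFields-15828), line `Sketch`, reshape 17-CS, helper 4 of `stub_csclOfLock`:
# Cauchy–Schwarz clustering with OS-norm constants on ONE odd torus, from per-observable clustering + positivity

Sequel of `…CsclChordSlack`. `cscl_torus_pair` — THE PER-TORUS STATEMENT of reshape 17-CS: on the torus of side `2S+1`
(`β ≥ 0`), for bounded measurable complex cylinder observables `X, Y` of the `ℤ⁴` gauge field supported at lattice times
in `[1, w]`, if the reflected connected time correlation of `X` with itself (resp. `Y` with itself) is `≤ D_X e^{−Mn}`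
(resp. `≤ D_Y e^{−Mn}`) for all `n ≤ S` — per-observable constants, as the crux's locked lattice gap gives them — and the
torus is long (`2w + N + 10 ≤ S`, `D e^{M} ≤ ε e^{MN/2}`), then for every shift `0 ≤ s ≤ N`
`‖∫ conj X(cfgReflect Ũ) Y(τˢŨ) dμ − conj ⟨X⟩⟨Y⟩‖ ≤ e^{−Ms/2} √V_X √V_Y + √ε (√V_X + √V_Y) + ε`,
`V_X = Re ∫ conj X(cfgReflect Ũ) X(Ũ)`: OS-NORM constants at half rate; the per-observable constants only enter the length
condition. Proof: the pairing is `P_{s+1}(X',Y')` for the centred back-shifted observables; by parity it is a bond- or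
site-form value of `(X'τᵃ, Y'τᵃ)`; Cauchy–Schwarz there, then `cscl_obs_chord` for `X` and for `Y`, then `cscl_sqrt_slack`.
Registered anchor: `cscl_anchor_pair`. Refs: Osterwalder–Seiler 1978 §2; Glimm–Jaffe 1987 §6.1. No definitions.
-/

noncomputable section

open scoped ComplexConjugate
open MeasureTheory Filter
open Literature.MathematicalPhysics.QuantumFieldTheory Literature.MathematicalPhysics.QuantumLattice
open Summit.QuantumFields.YangMills.Theorems.ClusteringToYangMills.Reconstructible
open Summit.QuantumFields.YangMills.Theorems.CriticalContinuumLimit.AdmissibleGap (maxTime)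

namespace Summit.QuantumFields.YangMills.Theorems.ContinuumLegGivenGap

section Torus

variable {G : Type} [Group G] [TopologicalSpace G] [IsTopologicalGroup G] [CompactSpace G]
  [MeasurableSpace G] [BorelSpace G] {N : ℕ} (ρ : G →* Matrix (Fin N) (Fin N) ℂ)

/-- **Cauchy–Schwarz clustering with OS norms on one odd torus** (see the module docstring). [folklore] -/
theorem cscl_torus_pair (hρ : Continuous ρ) {β : ℝ} (hβ : 0 ≤ β) {S w Nn : ℕ} {X Y : LGConfig 4 G → ℂ}
    (hXm : Measurable X) (hYm : Measurable Y) (hXb : ∃ C : ℝ, ∀ U, ‖X U‖ ≤ C) (hYb : ∃ C : ℝ, ∀ U, ‖Y U‖ ≤ C)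
    {ΛX ΛY : Finset (Literature.MathematicalPhysics.QuantumLattice.ZdEdge 4)} (hX : IsCylinder X ΛX) (hY : IsCylinder Y ΛY)
    (hΛX : ∀ e ∈ ΛX, 1 ≤ e.1 0 ∧ e.1 0 ≤ (w : ℤ)) (hΛY : ∀ e ∈ ΛY, 1 ≤ e.1 0 ∧ e.1 0 ≤ (w : ℤ))
    {M ε DX DY : ℝ} (hM : 0 ≤ M) (hε : 0 < ε) (hDX : 0 < DX) (hDY : 0 < DY) (hNn : 1 ≤ Nn) (hwin : 2 * w + Nn + 10 ≤ S)
    (hclX : ∀ n : ℕ, n ≤ S →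
      ‖(∫ U, conj (X (gaugeTimeReflect (torusLift (2 * S + 1) U))) *
          X (configShift (-(Pi.single 0 (n : ℤ))) (torusLift (2 * S + 1) U)) ∂(wilsonMeasure (d := 4) (L := 2 * S + 1) ρ β)) -
        conj (∫ V, X (torusLift (2 * S + 1) V) ∂(wilsonMeasure (d := 4) (L := 2 * S + 1) ρ β)) *
          ∫ V, X (torusLift (2 * S + 1) V) ∂(wilsonMeasure (d := 4) (L := 2 * S + 1) ρ β)‖ ≤ DX * Real.exp (-(M * n)))
    (hclY : ∀ n : ℕ, n ≤ S →
      ‖(∫ U, conj (Y (gaugeTimeReflect (torusLift (2 * S + 1) U))) *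
          Y (configShift (-(Pi.single 0 (n : ℤ))) (torusLift (2 * S + 1) U)) ∂(wilsonMeasure (d := 4) (L := 2 * S + 1) ρ β)) -
        conj (∫ V, Y (torusLift (2 * S + 1) V) ∂(wilsonMeasure (d := 4) (L := 2 * S + 1) ρ β)) *
          ∫ V, Y (torusLift (2 * S + 1) V) ∂(wilsonMeasure (d := 4) (L := 2 * S + 1) ρ β)‖ ≤ DY * Real.exp (-(M * n)))
    (hthrX : DX * Real.exp M ≤ ε * Real.exp (M * Nn / 2)) (hthrY : DY * Real.exp M ≤ ε * Real.exp (M * Nn / 2)) :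
    ∀ s : ℕ, s ≤ Nn →
      ‖(∫ U, conj (X (cfgReflect (torusLift (2 * S + 1) U))) *
            Y (configShift (-(Pi.single 0 (s : ℤ))) (torusLift (2 * S + 1) U)) ∂(wilsonMeasure (d := 4) (L := 2 * S + 1) ρ β)) -
          conj (∫ V, X (torusLift (2 * S + 1) V) ∂(wilsonMeasure (d := 4) (L := 2 * S + 1) ρ β)) *
            ∫ V, Y (torusLift (2 * S + 1) V) ∂(wilsonMeasure (d := 4) (L := 2 * S + 1) ρ β)‖ ≤
        Real.exp (-(M * s / 2)) *
            Real.sqrt (∫ U, conj (X (cfgReflect (torusLift (2 * S + 1) U))) * X (torusLift (2 * S + 1) U)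
              ∂(wilsonMeasure (d := 4) (L := 2 * S + 1) ρ β)).re *
            Real.sqrt (∫ U, conj (Y (cfgReflect (torusLift (2 * S + 1) U))) * Y (torusLift (2 * S + 1) U)
              ∂(wilsonMeasure (d := 4) (L := 2 * S + 1) ρ β)).re +
          Real.sqrt ε *
            (Real.sqrt (∫ U, conj (X (cfgReflect (torusLift (2 * S + 1) U))) * X (torusLift (2 * S + 1) U)
                ∂(wilsonMeasure (d := 4) (L := 2 * S + 1) ρ β)).re +
              Real.sqrt (∫ U, conj (Y (cfgReflect (torusLift (2 * S + 1) U))) * Y (torusLift (2 * S + 1) U)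
                ∂(wilsonMeasure (d := 4) (L := 2 * S + 1) ρ β)).re) + ε := by
  haveI := isProbabilityMeasure_wilsonMeasure (d := 4) (L := 2 * S + 1) ρ hρ β
  have hS1 : 1 ≤ S := by omega
  intro s hs
  set μW := wilsonMeasure (d := 4) (L := 2 * S + 1) ρ β with hμW
  set mX : ℂ := ∫ V, X (torusLift (2 * S + 1) V) ∂μW with hmX
  set mY : ℂ := ∫ V, Y (torusLift (2 * S + 1) V) ∂μW with hmY
  set VX : ℝ := (∫ U, conj (X (cfgReflect (torusLift (2 * S + 1) U))) * X (torusLift (2 * S + 1) U) ∂μW).re with hVX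
  set VY : ℝ := (∫ U, conj (Y (cfgReflect (torusLift (2 * S + 1) U))) * Y (torusLift (2 * S + 1) U) ∂μW).re with hVY
  obtain ⟨CX, hCX⟩ := hXb
  obtain ⟨CY, hCY⟩ := hYb
  -- centred, back-shifted observables
  set Xc : LGConfig 4 G → ℂ := fun V => X V - mX with hXc
  set Yc : LGConfig 4 G → ℂ := fun V => Y V - mY with hYc
  set X' : LGConfig 4 G → ℂ := fun V => Xc (configShift (-(Pi.single 0 (-1))) V) with hX'
  set Y' : LGConfig 4 G → ℂ := fun V => Yc (configShift (-(Pi.single 0 (-1))) V) with hY'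
  have hXcm : Measurable Xc := hXm.sub measurable_const
  have hYcm : Measurable Yc := hYm.sub measurable_const
  have hXcb : ∃ C : ℝ, ∀ U, ‖Xc U‖ ≤ C := ⟨CX + ‖mX‖, fun U => (norm_sub_le _ _).trans (add_le_add (hCX U) le_rfl)⟩
  have hYcb : ∃ C : ℝ, ∀ U, ‖Yc U‖ ≤ C := ⟨CY + ‖mY‖, fun U => (norm_sub_le _ _).trans (add_le_add (hCY U) le_rfl)⟩
  have hXcc : IsCylinder Xc ΛX := fun U V hUV => by show X U - mX = X V - mX; rw [hX hUV]
  have hYcc : IsCylinder Yc ΛY := fun U V hUV => by show Y U - mY = Y V - mY; rw [hY hUV]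
  obtain ⟨ΛX', hX'c, hΛX'⟩ := cscl_isCylinder_shift hXcc (-1) hΛX
  obtain ⟨ΛY', hY'c, hΛY'⟩ := cscl_isCylinder_shift hYcc (-1) hΛY
  have hΛX'' : ∀ e ∈ ΛX', 0 ≤ e.1 0 ∧ e.1 0 ≤ (w : ℤ) := fun e he => by have := hΛX' e he; omega
  have hΛY'' : ∀ e ∈ ΛY', 0 ≤ e.1 0 ∧ e.1 0 ≤ (w : ℤ) := fun e he => by have := hΛY' e he; omega
  have hX'm : Measurable X' := hXcm.comp (configShift _).measurable
  have hY'm : Measurable Y' := hYcm.comp (configShift _).measurable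
  have hX'b : ∃ C : ℝ, ∀ U, ‖X' U‖ ≤ C := hXcb.imp fun C hC U => hC _
  have hY'b : ∃ C : ℝ, ∀ U, ‖Y' U‖ ≤ C := hYcb.imp fun C hC U => hC _
  -- the chords for `X` and for `Y`
  obtain ⟨hnnX, hchX, hVX0⟩ := cscl_obs_chord ρ hρ hβ hXm ⟨CX, hCX⟩ hX hΛX hM hε hDX hNn hwin hclX hthrX
  obtain ⟨hnnY, hchY, hVY0⟩ := cscl_obs_chord ρ hρ hβ hYm ⟨CY, hCY⟩ hY hΛY hM hε hDY hNn hwin hclY hthrY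
  -- the target pairing is `P_{s+1}(X',Y')`
  have htarget : (∫ U, conj (X (cfgReflect (torusLift (2 * S + 1) U))) *
        Y (configShift (-(Pi.single 0 (s : ℤ))) (torusLift (2 * S + 1) U)) ∂μW) - conj mX * mY =
      ∫ U, conj (X' (gaugeTimeReflect (torusLift (2 * S + 1) U))) *
        Y' (configShift (-(Pi.single 0 ((s : ℤ) + 1))) (torusLift (2 * S + 1) U)) ∂μW := by
    rw [cscl_site_pairing_eq ρ β (2 * S + 1) X Y s, ← cscl_centre_identity ρ hρ β (2 * S + 1) hXm hYm ⟨CX, hCX⟩ ⟨CY, hCY⟩]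
    have h := cscl_shift_pair ρ β (2 * S + 1) Xc Yc (-1) (s : ℤ)
    rw [← h]
    refine integral_congr_ae (Eventually.of_forall fun U => ?_)
    simp only [hX', hY', rpShift_configShift_configShift]
    ring_nf
  rw [htarget]
  -- Cauchy–Schwarz in the form of the right parity
  have hcs : ‖∫ U, conj (X' (gaugeTimeReflect (torusLift (2 * S + 1) U))) *
        Y' (configShift (-(Pi.single 0 ((s : ℤ) + 1))) (torusLift (2 * S + 1) U)) ∂μW‖ ^ 2 ≤
      (∫ U, conj (X' (gaugeTimeReflect (torusLift (2 * S + 1) U))) *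
          X' (configShift (-(Pi.single 0 ((s + 1 : ℕ) : ℤ))) (torusLift (2 * S + 1) U)) ∂μW).re *
      (∫ U, conj (Y' (gaugeTimeReflect (torusLift (2 * S + 1) U))) *
          Y' (configShift (-(Pi.single 0 ((s + 1 : ℕ) : ℤ))) (torusLift (2 * S + 1) U)) ∂μW).re := by
    have hshm : ∀ (Z : LGConfig 4 G → ℂ), Measurable Z → ∀ b : ℤ,
        Measurable fun V => Z (configShift (-(Pi.single 0 b)) V) := fun Z hZ b => hZ.comp (configShift _).measurable
    have hshb : ∀ (Z : LGConfig 4 G → ℂ), (∃ C : ℝ, ∀ U, ‖Z U‖ ≤ C) → ∀ b : ℤ,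
        ∃ C : ℝ, ∀ U, ‖Z (configShift (-(Pi.single 0 b)) U)‖ ≤ C := fun Z hZ b => hZ.imp fun C hC U => hC _
    obtain ⟨a, ha⟩ := Nat.even_or_odd' (s + 1)
    obtain ⟨Λ1, hA1, hΛ1⟩ := cscl_isCylinder_shift hX'c (a : ℤ) hΛX''
    obtain ⟨Λ2, hA2, hΛ2⟩ := cscl_isCylinder_shift hY'c (a : ℤ) hΛY''
    obtain ⟨hpos1, hmax1⟩ := cscl_timeSupp_finset hΛ1 (by omega)
    obtain ⟨hpos2, hmax2⟩ := cscl_timeSupp_finset hΛ2 (by omega)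
    rcases ha with h2 | h2
    · -- `s + 1 = 2a`: bond form of `(X'τᵃ, Y'τᵃ)`
      have hS1' : maxTime Λ1 + 1 ≤ S := by
        have : (maxTime Λ1 : ℤ) ≤ max ((w : ℤ) + a) 0 := hmax1
        omega
      have hS2' : maxTime Λ2 + 1 ≤ S := by
        have : (maxTime Λ2 : ℤ) ≤ max ((w : ℤ) + a) 0 := hmax2
        omega
      obtain ⟨hc, -, -⟩ := cscl_bond_cs ρ hρ hβ hS1 (hshm X' hX'm a) (hshm Y' hY'm a) (hshb X' hX'b a)
        (hshb Y' hY'b a) hA1 hA2 hpos1 hpos2 hS1' hS2'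
      have e12 := cscl_shift_pair ρ β (2 * S + 1) X' Y' (a : ℤ) (a : ℤ)
      have e11 := cscl_shift_pair ρ β (2 * S + 1) X' X' (a : ℤ) (a : ℤ)
      have e22 := cscl_shift_pair ρ β (2 * S + 1) Y' Y' (a : ℤ) (a : ℤ)
      have c1 : ((a : ℤ) + a) = (s : ℤ) + 1 := by omega
      have c2 : ((a : ℤ) + a) = ((s + 1 : ℕ) : ℤ) := by omega
      rw [c1] at e12; rw [c2] at e11 e22
      rw [e12, e11, e22] at hc
      exact hc
    · -- `s + 1 = 2a + 1`: site form of `(X'τᵃ, Y'τᵃ)`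
      have hS1' : maxTime Λ1 + 2 ≤ S := by
        have : (maxTime Λ1 : ℤ) ≤ max ((w : ℤ) + a) 0 := hmax1
        omega
      have hS2' : maxTime Λ2 + 2 ≤ S := by
        have : (maxTime Λ2 : ℤ) ≤ max ((w : ℤ) + a) 0 := hmax2
        omega
      obtain ⟨hc, -, -⟩ := cscl_site_cs ρ hρ hβ (hshm X' hX'm a) (hshm Y' hY'm a) (hshb X' hX'b a)
        (hshb Y' hY'b a) hA1 hA2 hpos1 hpos2 hS1' hS2'
      have e12 := cscl_shift_pair ρ β (2 * S + 1) X' Y' (a : ℤ) ((a : ℤ) + 1)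
      have e11 := cscl_shift_pair ρ β (2 * S + 1) X' X' (a : ℤ) ((a : ℤ) + 1)
      have e22 := cscl_shift_pair ρ β (2 * S + 1) Y' Y' (a : ℤ) ((a : ℤ) + 1)
      have hτ : ∀ (W : LGConfig 4 G), configShift (-(Pi.single 0 ((a : ℤ) + 1))) W =
          configShift (-(Pi.single 0 (a : ℤ))) (gaugeTimeShift W) := fun W =>
        (rpShift_configShift_gaugeTimeShift (a : ℤ) W).symm
      simp only [hτ] at e12 e11 e22
      have c1 : ((a : ℤ) + (a + 1)) = (s : ℤ) + 1 := by omega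
      have c2 : ((a : ℤ) + (a + 1)) = ((s + 1 : ℕ) : ℤ) := by omega
      rw [c1] at e12; rw [c2] at e11 e22
      rw [e12, e11, e22] at hc
      exact hc
  -- the two chords, then the slack algebra
  have hgX := hchX s hs
  have hgY := hchY s hs
  have hexp0 : 0 < Real.exp (-(M * s / 2)) := Real.exp_pos _
  set aX : ℝ := VX * Real.exp (-(M * s / 2)) with haX
  set aY : ℝ := VY * Real.exp (-(M * s / 2)) with haY
  have haX0 : 0 ≤ aX := mul_nonneg hVX0 hexp0.le
  have haY0 : 0 ≤ aY := mul_nonneg hVY0 hexp0.le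
  have hsq : ‖∫ U, conj (X' (gaugeTimeReflect (torusLift (2 * S + 1) U))) *
      Y' (configShift (-(Pi.single 0 ((s : ℤ) + 1))) (torusLift (2 * S + 1) U)) ∂μW‖ ^ 2 ≤ (aX + ε) * (aY + ε) := by
    refine hcs.trans ?_
    have h1 := (hnnY (s + 1) (by omega)).1
    exact mul_le_mul hgX hgY h1 (by linarith)
  have hnorm : ‖∫ U, conj (X' (gaugeTimeReflect (torusLift (2 * S + 1) U))) *
      Y' (configShift (-(Pi.single 0 ((s : ℤ) + 1))) (torusLift (2 * S + 1) U)) ∂μW‖ ≤ Real.sqrt ((aX + ε) * (aY + ε)) := by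
    rw [← Real.sqrt_sq (norm_nonneg _)]
    exact Real.sqrt_le_sqrt hsq
  refine hnorm.trans ((cscl_sqrt_slack haX0 haY0 hε.le).trans ?_)
  -- `√aX √aY = e^{-Ms/2} √VX √VY`, `√aX ≤ √VX`, `√aY ≤ √VY`
  have hsaX : Real.sqrt aX = Real.sqrt VX * Real.sqrt (Real.exp (-(M * s / 2))) := Real.sqrt_mul hVX0 _
  have hsaY : Real.sqrt aY = Real.sqrt VY * Real.sqrt (Real.exp (-(M * s / 2))) := Real.sqrt_mul hVY0 _
  have hee : Real.sqrt (Real.exp (-(M * s / 2))) * Real.sqrt (Real.exp (-(M * s / 2))) = Real.exp (-(M * s / 2)) :=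
    Real.mul_self_sqrt hexp0.le
  have he1 : Real.sqrt (Real.exp (-(M * s / 2))) ≤ 1 := by
    rw [Real.sqrt_le_one]
    have : 0 ≤ M * s / 2 := by positivity
    exact Real.exp_le_one_iff.2 (by linarith)
  have hprod : Real.sqrt aX * Real.sqrt aY = Real.exp (-(M * s / 2)) * Real.sqrt VX * Real.sqrt VY := by
    rw [hsaX, hsaY, show Real.sqrt VX * Real.sqrt (Real.exp (-(M * s / 2))) *
        (Real.sqrt VY * Real.sqrt (Real.exp (-(M * s / 2)))) =
      (Real.sqrt (Real.exp (-(M * s / 2))) * Real.sqrt (Real.exp (-(M * s / 2)))) * Real.sqrt VX * Real.sqrt VY by ring,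
      hee]
  have hle1 : Real.sqrt aX ≤ Real.sqrt VX := by
    rw [hsaX]; exact mul_le_of_le_one_right (Real.sqrt_nonneg _) he1
  have hle2 : Real.sqrt aY ≤ Real.sqrt VY := by
    rw [hsaY]; exact mul_le_of_le_one_right (Real.sqrt_nonneg _) he1
  have hsε := Real.sqrt_nonneg ε
  have hfin := mul_le_mul_of_nonneg_left (add_le_add hle1 hle2) hsε
  linarith [hprod, hfin]

end Torus

/-- **Registered anchor of this file** (a closed elementary consequence, for the gate's `--supports` stub check):
`√(V e^{−t}) ≤ √V` for `V ≥ 0`, `t ≥ 0`. [folklore] -/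
theorem cscl_anchor_pair :
    ∀ (V t : ℝ), 0 ≤ V → 0 ≤ t → Real.sqrt (V * Real.exp (-t)) ≤ Real.sqrt V := by
  intro V t hV ht
  rw [Real.sqrt_mul hV]
  refine mul_le_of_le_one_right (Real.sqrt_nonneg _) ?_
  rw [Real.sqrt_le_one]
  exact Real.exp_le_one_iff.2 (by linarith)

end Summit.QuantumFields.YangMills.Theorems.ContinuumLegGivenGap

end
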